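import Summits.HodgeConjecture.HodgeConjecture.Theorems.F0P3HolProjectionReduction
import Summits.HodgeConjecture.HodgeConjecture.Theorems.F0P2aCmFrameFactorisation
import Literature.NumberTheory.Automorphic.DiscreteAutomorphicRepSmoothRepresentative
import Literature.NumberTheory.Automorphic.UnitaryGroupCotangentSpectralProjectionConj
import Literature.NumberTheory.Automorphic.UnitaryGroupCongruenceLevels
import Literature.RepresentationTheory.KonnoKonno2007.JunctionCartanDecomposition
import Mathlib.GroupTheory.NoncommCoprod
import Mathlib.Topology.Algebra.OpenSubgroup
import HarnessLib

/-!
# Crux `H413`, line `F0_U3CohMultOne` — P3 RUNG 1: letter (D)h FROM letter F2 ALONE (the fold `holCotFormSpectralProjection_of_F2`)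

Floor-0 programme P3 «U3-mult», seat F0P3-p02 (g3); crux item stmt-HodgeConjecture-24833 (`HCCMUnconditional.H413`); ENGINE-INTERFACES §7j
(«(D)h at rung 1 = F2 alone»), brief B3.  HC_CM is proved only modulo the printed citations until rung 0 closes.

Letter (D)h ★ `CotangentForms.holCotFormSpectralProjection` (the spectral projection `pr_P` of the pair of classes of a holomorphic cotangent
form is the pair of classes of a holomorphic cotangent form) was reduced by the p02 (g2) chain (★ `F0P3FormProjection`, ★
`F0P3ProjectionPreservesType`, ★ `F0P3ProjectionHolGermTransport`, ★ `F0P3HolProjectionReduction`) to ONE analytic input: an arch-smooth continuous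
left-invariant representative of the projected classes with continuous Lie derivatives — exactly the output of letter F2 ★
`DiscreteAutomorphicRep.KFiniteSmoothRepresentative` («`K`-finite vectors of a discrete automorphic representation on a compact quotient, fixed by
a compact `U` commuting with the archimedean factor `ι(H)` with `ι(H)·U` open, are classes of smooth automorphic forms», [Borel1997, Thm. 2.13–2.14];
[BorelJacquet1979, §4.3, §4.6]).  This file discharges the four STRUCTURAL hypotheses of F2 at the CM frame `(H, ι) = (U(2,1), cmArchSection)` and folds:

* §1 `U(2,1)`: the global Cartan decomposition of ★ `BallForms.u21Group` (`u21Group_hasCartanDecomposition`, = ★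
  `unitaryFormGroup_hasCartanDecomposition` of A-p09 at `J = diag(1,1,-1)`: the two linear real groups have the same carrier and Lie algebra), and
  «`K_∞ = U(2,1) ∩ U(3)` FIXES THE ORIGIN of the ball» (`smul_x₀_eq_of_star_mul_self`, `mk_mem_stabilizer_x₀`: a unitary element of `U(2,1)`
  commutes with `J`, hence is block-diagonal; [Jacobowitz1990, Ch. 2 §1 Lemma 6(2)]) — the bridge from `RealMatrixGroup.maximalCompact` (the `K` of ★
  `kFiniteVectors`) to `Stab_{U(2,1)}(x₀)` (the `K_∞` of ★ `holCotForms`).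
* §2 (generic unitary datum) `mem_kFiniteVectors_of_coe_eq`: the projected class `pr_P [Φ_j]` of a holomorphic cotangent form is a `K`-FINITE vector of
  `P|_{U(2,1)}` — its `K_∞`-orbit stays in the plane `ℂ pr_P[Φ₀] + ℂ pr_P[Φ₁]` by the class-level `K_∞`-type ★ `projectedClasses_type` (4).
* §3 (the CM frame of the letter) `exists_commuting_complement_cmArchSection`: F2's commuting-factor hypothesis `hfac` — the centraliser of
  `ι_∞(U(2,1))` is a complement, by the frame factorisation ★ `F0P2aCmFrameFactorisation` (`x = ι_∞(u) · k · (1, x_f)`, the three factors pairwise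
  commuting); `exists_compact_open_level`: the compact subgroup `U = K_c · (1, K_f⁰ ∩ Stab(Φ))` (★ `isCompact_cmCompactFactor`, ★
  `isCompact_isOpen_finCongruenceLevel_top`, ★ `isOpen_stabilizer`) commutes with `ι_∞(U(2,1))`, `ι_∞(U(2,1)) · U ⊇ {x : x_f ∈ K_f⁰ ∩ Stab(Φ)}` is open,
  and `U` fixes the projected classes (★ `projectedClasses_type` (2)(3)).
* §4 THE FOLD: `holCotFormSpectralProjection_at_of_F2` — for ONE `P`, `P.KFiniteSmoothRepresentative u21Group cmArchSection` gives the conclusion of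
  (D)h for `P` and every `Φ` (F2's representatives of `pr_P[Φ₀]`, `pr_P[Φ₁]`, bundled, fed to ★ `holCotFormSpectralProjection_of_archSmooth_representative`);
  **`holCotFormSpectralProjection_of_F2`** — letter F2 at every CM frame ⇒ letter (D)h, BY NAME on both sides; and by complex conjugation (F0P2-p01's ★
  `antiholCotFormSpectralProjection_of_hol`) `antiholCotFormSpectralProjection_of_F2`, `cotFormSpectralProjection_of_F2 : (D) ∧ (D̄)`.

No definition, no sorry, no new letter: (D)h (and (D̄)) leave the letter head of `hJ3a` in favour of F2 (★ `HJ3aOfFiveLetters.hJ3a_of_five_letters hE1 hE1'h hE2'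
(holCotFormSpectralProjection_of_F2 hF2) hEh`).

References: [Borel1997] A. Borel, *Automorphic forms on SL₂(ℝ)* (1997), Thm. 2.13–2.14, §5.14; [BorelJacquet1979] A. Borel, H. Jacquet, Corvallis
PSPM 33.1 (1979), §4.1, §4.3, §4.6; [BorelWallach2000] Ch. 0 §2.4, VII 2.10, XIII 1.2; [Knapp2002] Thm. 6.31 (c), Prop. 7.14; [Jacobowitz1990] Ch. 2 §1
Lemma 6(2); [PlatonovRapinchuk1994] §5.1.
-/

-- the mandated namespace repeats `HodgeConjecture.HodgeConjecture`, as in every `Theorems/*.lean` of this sub-problem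
set_option linter.dupNamespace false

noncomputable section

open MeasureTheory NumberField MulAction Filter Topology
open scoped ENNReal Matrix ComplexOrder

namespace Summit.HodgeConjecture.HodgeConjecture.Cruxes.H413.F0P3HolProjectionOfF2

open Literature.NumberTheory.Automorphic Literature.NumberTheory.Automorphic.UnitaryGroup
open Literature.NumberTheory.Automorphic.UnitaryGroup.CotangentForms (toQuotFun holCotForms rightRep cmArchSection cmCompactFactor
  isCompact_cmCompactFactor holCotFormSpectralProjection antiholCotFormSpectralProjection antiholCotFormSpectralProjection_of_hol)
open Literature.AlgebraicGeometry.ShimuraVarieties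
open Literature.Geometry.ComplexHyperbolic
open Literature.Geometry.ComplexHyperbolic.BallModel (U21 x₀ x₀_val mat mat_mem smul_val W3_apply Ball.ext)
open Literature.RepresentationTheory.KonnoKonno2007 (unitaryFormGroup unitaryFormGroup_hasCartanDecomposition
  mem_unitaryFormGroup_carrier_iff mem_unitaryFormGroup_lie_iff)
open Summit.HodgeConjecture.HodgeConjecture.Cruxes.H413.F0P3ProjectionPreservesType (projectedClasses_type)
open Summit.HodgeConjecture.HodgeConjecture.Cruxes.H413.F0P3HolProjectionReduction
  (compactSpace_automorphicQuotient_cm holCotFormSpectralProjection_of_archSmooth_representative)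
open Summit.HodgeConjecture.HodgeConjecture.Cruxes.H413.F0P2aCmFrameFactorisation
  (cmArchSection_mul_finAdelicToAdelic cmArchSection_mul_of_mem_cmCompactFactor mul_finAdelicToAdelic_of_mem_cmCompactFactor
    exists_eq_cmArchSection_mul_cmCompactFactor_mul_finAdelicToAdelic)

/-! ## §1 `U(2,1)`: global Cartan decomposition, and `K_∞ = U(2,1) ∩ U(3)` fixes the origin of the ball -/

section U21

/-- **The global Cartan decomposition `U(2,1) = (U(2,1) ∩ U(3)) · exp 𝔭` of ★ `BallForms.u21Group`** (`RealMatrixGroup.HasCartanDecomposition`),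
read off A-p09's ★ `unitaryFormGroup_hasCartanDecomposition` at the hermitian involution `J = diag(1,1,-1)`: the linear real groups
`BallForms.u21Group` and `unitaryFormGroup J` have the same carrier `{g : gᴴ J g = J}` and the same Lie algebra `{X : Xᴴ J + J X = 0}`.
[cite: Knapp2002, Thm. 6.31 (c); Prop. 7.14] -/
theorem u21Group_hasCartanDecomposition : BallForms.u21Group.HasCartanDecomposition := by
  intro g hg
  have hg' : g ∈ (unitaryFormGroup BallModel.J BallForms.conjTranspose_J BallModel.J_mul_J).carrier :=
    (mem_unitaryFormGroup_carrier_iff _ _ _ g).2 hg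
  obtain ⟨k, hk, X, hX, hsa, hgk⟩ :=
    unitaryFormGroup_hasCartanDecomposition BallModel.J BallForms.conjTranspose_J BallModel.J_mul_J g hg'
  refine ⟨k, ?_, X, (BallForms.mem_u21Lie_iff X).2 ((mem_unitaryFormGroup_lie_iff _ _ _ X).1 hX), hsa, hgk⟩
  rw [RealMatrixGroup.mem_maximalCompact_iff] at hk ⊢
  exact ⟨(mem_unitaryFormGroup_carrier_iff _ _ _ k).1 hk.1, hk.2⟩

/-- **A unitary element of `U(2,1)` fixes the origin of the ball**: if `g ∈ U(2,1)` has `gᴴ g = 1` then `gᴴ J g = J` forces `J g = g J`, so `g`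
is block-diagonal (`g_{i,2} = 0` for `i < 2`) and `g • x₀ = (g_{0,2}, g_{1,2}) / g_{2,2} = x₀`. [cite: Jacobowitz1990, Ch. 2 §1 Lemma 6(2)] -/
theorem smul_x₀_eq_of_star_mul_self (g : U21) (hg : star (mat g) * mat g = 1) : g • x₀ = x₀ := by
  have hJ : (mat g)ᴴ * BallModel.J * mat g = BallModel.J := mat_mem g
  have hu : (mat g)ᴴ * mat g = 1 := hg
  have hu' : mat g * (mat g)ᴴ = 1 := mul_eq_one_comm.mp hu
  have hcomm : BallModel.J * mat g = mat g * BallModel.J := by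
    calc BallModel.J * mat g = mat g * (mat g)ᴴ * BallModel.J * mat g := by rw [hu', Matrix.one_mul]
      _ = mat g * ((mat g)ᴴ * BallModel.J * mat g) := by simp only [Matrix.mul_assoc]
      _ = mat g * BallModel.J := by rw [hJ]
  apply Ball.ext
  intro i
  have hi : mat g (Fin.castSucc i) 2 = 0 := by
    have h := congrFun (congrFun hcomm (Fin.castSucc i)) 2
    rw [BallModel.J, Matrix.diagonal_mul, Matrix.mul_diagonal] at h
    fin_cases i <;> simpa [self_eq_neg] using h
  rw [smul_val, W3_apply, W3_apply, x₀_val, Pi.zero_apply, Pi.zero_apply, mul_zero, mul_zero, zero_add, zero_add, hi, zero_div,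
    Pi.zero_apply]

/-- **`K_∞ = U(2,1) ∩ U(3)` (★ `RealMatrixGroup.maximalCompact` of `u21Group`) lies in the stabiliser `Stab_{U(2,1)}(x₀)` of the origin** — the
bridge from the `K` of ★ `kFiniteVectors` to the `K_∞` of ★ `holCotForms`. [cite: Jacobowitz1990, Ch. 2 §1 Lemma 6(2)] [cite: BorelWallach2000, VI 4.7–4.8] -/
theorem mk_mem_stabilizer_x₀ (k : BallForms.u21Group.maximalCompact) :
    (⟨(k : GL (Fin 3) ℂ), BallForms.u21Group.maximalCompact_le_carrier k.2⟩ : U21) ∈ stabilizer U21 x₀ := by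
  rw [MulAction.mem_stabilizer_iff]
  exact smul_x₀_eq_of_star_mul_self _ ((BallForms.u21Group.mem_maximalCompact_iff (k : GL (Fin 3) ℂ)).1 k.2).2

end U21

/-! ## §2 The projected classes of a holomorphic cotangent form are `K`-finite vectors of `P|_{U(2,1)}` (generic unitary datum) -/

section KFinite

variable {F E : Type} [Field F] [NumberField F] [Field E] [NumberField E] [Algebra F E]
  {c : E ≃ₐ[F] E} {N : ℕ} {J : Matrix (Fin N) (Fin N) E}
  {ιinf : U21 →* (adelicGroupData F E c N J).Adelic} {Kc : Subgroup (adelicGroupData F E c N J).Adelic}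
  {μ : Measure (adelicGroupData F E c N J).automorphicQuotient} [(adelicGroupData F E c N J).IsAutomorphicMeasure μ]

/-- **The projected class `pr_P [Φ_j]` of a holomorphic cotangent form is a `K`-FINITE vector of `P|_{U(2,1)}`** (★ `kFiniteVectors u21Group
(P.archRep u21Group ιinf)`, `K = U(2,1) ∩ U(3)`): `K ≤ Stab(x₀)` (§1) and `R(ιinf k) pr_P[Φ_j] = ∑ᵢ (τ k⁻¹)_{j i} • pr_P[Φᵢ]` (★ `projectedClasses_type` (4)),
so the `K`-orbit spans a subspace of the plane `ℂ pr_P[Φ₀] + ℂ pr_P[Φ₁]`. [cite: BorelJacquet1979, §4.2 and §4.6] [cite: BorelWallach2000, Ch. 0 §2.4] -/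
theorem mem_kFiniteVectors_of_coe_eq (P : DiscreteAutomorphicRep (adelicGroupData F E c N J) μ)
    {Φ : (adelicGroupData F E c N J).Adelic → (Fin 2 → ℂ)} (hΦ : Φ ∈ holCotForms F E c N J ιinf Kc)
    (hmem : ∀ j : Fin 2, MemLp (toQuotFun (adelicGroupData F E c N J) fun x => Φ x j) 2 μ) (j : Fin 2)
    {v : P.space.toSubmodule} (hv : (v : (adelicGroupData F E c N J).L2 μ) = P.space.toSubmodule.starProjection ((hmem j).toLp _)) :
    v ∈ kFiniteVectors BallForms.u21Group (P.archRep BallForms.u21Group ιinf) := by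
  rw [DiscreteAutomorphicRep.mem_kFiniteVectors_archRep_iff, hv]
  set W : Submodule ℂ ((adelicGroupData F E c N J).L2 μ) :=
    Submodule.span ℂ (Set.range fun i : Fin 2 => P.space.toSubmodule.starProjection ((hmem i).toLp _)) with hW
  haveI : FiniteDimensional ℂ W := FiniteDimensional.span_of_finite ℂ (Set.finite_range _)
  refine Submodule.finiteDimensional_of_le (S₂ := W) (Submodule.span_le.mpr ?_)
  rintro _ ⟨k, rfl⟩
  -- the `K_∞`-type relation for `k ∈ K ≤ Stab(x₀)`, stated on the element `⟨k, _⟩ : U(2,1)` (definitionally the inclusion of `k`)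
  have hmemW : (adelicGroupData F E c N J).rightRegular μ (ιinf ⟨(k : GL (Fin 3) ℂ), BallForms.u21Group.maximalCompact_le_carrier k.2⟩)
      (P.space.toSubmodule.starProjection ((hmem j).toLp _)) ∈ W := by
    rw [(projectedClasses_type P hΦ hmem).2.2.2 ⟨_, mk_mem_stabilizer_x₀ k⟩ j]
    exact Submodule.sum_mem _ fun i _ => Submodule.smul_mem _ _ (Submodule.subset_span ⟨i, rfl⟩)
  exact hmemW

end KFinite

/-! ## §3 The CM frame of the letter: F2's structural hypotheses `hfac`, `U`, `hUc`, `hcomm`, `hopen`, `hU` -/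

section CM

variable {L : Type} [Field L] [NumberField L] [IsCMField L] {ι : L →+* ℂ} {H : Matrix (Fin 3) (Fin 3) L} {T : GL (Fin 3) ℂ}
  {hT : (T : Matrix (Fin 3) (Fin 3) ℂ)ᴴ * H.map ι * (T : Matrix (Fin 3) (Fin 3) ℂ) = BallModel.J}

/-- **F2's commuting-factor hypothesis `hfac` at the CM frame**: the centraliser `C` of `ι_∞(U(2,1))` in `U(H)(𝔸_{L⁺})` is a complement —
`U(H)(𝔸_{L⁺}) = ι_∞(U(2,1)) · C` — since every `x` is `ι_∞(u) · k · (1, x_f)` with `k ∈ K_c` and the three factors pairwise commute (★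
`F0P2aCmFrameFactorisation`). [cite: BorelJacquet1979, §4.1] [cite: PlatonovRapinchuk1994, §5.1] -/
theorem exists_commuting_complement_cmArchSection (hT : (T : Matrix (Fin 3) (Fin 3) ℂ)ᴴ * H.map ι * (T : Matrix (Fin 3) (Fin 3) ℂ) = BallModel.J) :
    ∃ C : Subgroup (adelicGroupData (↥(maximalRealSubfield L)) L (IsCMField.complexConj L) 3 H).Adelic,
      (∀ (h : U21) (c : (adelicGroupData (↥(maximalRealSubfield L)) L (IsCMField.complexConj L) 3 H).Adelic), c ∈ C →
          cmArchSection L ι H T hT h * c = c * cmArchSection L ι H T hT h) ∧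
        ∀ g : (adelicGroupData (↥(maximalRealSubfield L)) L (IsCMField.complexConj L) 3 H).Adelic,
          ∃ (h : U21) (c : (adelicGroupData (↥(maximalRealSubfield L)) L (IsCMField.complexConj L) 3 H).Adelic),
            c ∈ C ∧ g = cmArchSection L ι H T hT h * c := by
  refine ⟨Subgroup.centralizer (Set.range (cmArchSection L ι H T hT)),
    fun h c hc => Subgroup.mem_centralizer_iff.1 hc _ ⟨h, rfl⟩, fun g => ?_⟩
  obtain ⟨k, hk, hg⟩ := exists_eq_cmArchSection_mul_cmCompactFactor_mul_finAdelicToAdelic L ι H T hT g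
  refine ⟨_, k * finAdelicToAdelic (↥(maximalRealSubfield L)) L (IsCMField.complexConj L) 3 H
      (finPart (↥(maximalRealSubfield L)) L (IsCMField.complexConj L) 3 H g), ?_, hg.trans (mul_assoc _ _ _)⟩
  rw [Subgroup.mem_centralizer_iff]
  rintro _ ⟨u, rfl⟩
  rw [← mul_assoc, cmArchSection_mul_of_mem_cmCompactFactor L ι H T hT u hk, mul_assoc,
    cmArchSection_mul_finAdelicToAdelic L ι H T hT u, ← mul_assoc]

/-- **F2's compact subgroup `U` at the CM frame, for a holomorphic cotangent form `Φ`.**  With `K_f⁰` the integral level of `U(H)(𝔸_{L⁺,f})` (compact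
open, ★ `isCompact_isOpen_finCongruenceLevel_top`) and `Stab(Φ)` the open stabiliser of `Φ` (★ `projectedClasses_type` (3)), the subgroup
`U = K_c · (1, K_f⁰ ∩ Stab(Φ))` (a group: the two factors commute) is COMPACT (`K_c` is, `H` being definite away from `ι`: ★ `isCompact_cmCompactFactor`),
commutes with `ι_∞(U(2,1))`, the subgroup generated by `ι_∞(U(2,1))` and `U` contains the open set `{x : x_f ∈ K_f⁰ ∩ Stab(Φ)}` hence is OPEN, and `U` FIXES
the projected classes `pr_P [Φ_j]` (★ `projectedClasses_type` (2)(3)). [cite: BorelJacquet1979, §4.1 and §4.6] [cite: PlatonovRapinchuk1994, §5.1] -/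
theorem exists_compact_open_level
    (hdef : ∀ τ' : L →+* ℂ, InfinitePlace.mk τ' ≠ InfinitePlace.mk ι → (H.map τ').PosDef)
    {μ : Measure (adelicGroupData (↥(maximalRealSubfield L)) L (IsCMField.complexConj L) 3 H).automorphicQuotient}
    [(adelicGroupData (↥(maximalRealSubfield L)) L (IsCMField.complexConj L) 3 H).IsAutomorphicMeasure μ]
    (P : DiscreteAutomorphicRep (adelicGroupData (↥(maximalRealSubfield L)) L (IsCMField.complexConj L) 3 H) μ)
    {Φ : (adelicGroupData (↥(maximalRealSubfield L)) L (IsCMField.complexConj L) 3 H).Adelic → (Fin 2 → ℂ)}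
    (hΦ : Φ ∈ holCotForms (↥(maximalRealSubfield L)) L (IsCMField.complexConj L) 3 H (cmArchSection L ι H T hT) (cmCompactFactor L ι H T hT))
    (hmemΦ : ∀ j : Fin 2, MemLp (toQuotFun (adelicGroupData (↥(maximalRealSubfield L)) L (IsCMField.complexConj L) 3 H) fun g => Φ g j) 2 μ) :
    ∃ U : Subgroup (adelicGroupData (↥(maximalRealSubfield L)) L (IsCMField.complexConj L) 3 H).Adelic,
      IsCompact (U : Set (adelicGroupData (↥(maximalRealSubfield L)) L (IsCMField.complexConj L) 3 H).Adelic) ∧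
        (∀ (h : U21) (u : (adelicGroupData (↥(maximalRealSubfield L)) L (IsCMField.complexConj L) 3 H).Adelic), u ∈ U →
            cmArchSection L ι H T hT h * u = u * cmArchSection L ι H T hT h) ∧
          IsOpen (((cmArchSection L ι H T hT).range ⊔ U :
              Subgroup (adelicGroupData (↥(maximalRealSubfield L)) L (IsCMField.complexConj L) 3 H).Adelic) :
            Set (adelicGroupData (↥(maximalRealSubfield L)) L (IsCMField.complexConj L) 3 H).Adelic) ∧
            ∀ u ∈ U, ∀ j : Fin 2,
              (adelicGroupData (↥(maximalRealSubfield L)) L (IsCMField.complexConj L) 3 H).rightRegular μ u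
                  (P.space.toSubmodule.starProjection ((hmemΦ j).toLp _)) =
                P.space.toSubmodule.starProjection ((hmemΦ j).toLp _) := by
  obtain ⟨-, hKc, ⟨hSo, hlev⟩, -⟩ := projectedClasses_type P hΦ hmemΦ
  obtain ⟨hK0c, hK0o⟩ := isCompact_isOpen_finCongruenceLevel_top (↥(maximalRealSubfield L)) L (IsCMField.complexConj L) 3 H
  -- the compact open level `V = K_f⁰ ∩ Stab(Φ)` of the finite-adelic group
  set S : Subgroup (finAdelic (↥(maximalRealSubfield L)) L (IsCMField.complexConj L) 3 H) :=
    (rightRep (↥(maximalRealSubfield L)) L (IsCMField.complexConj L) 3 H).stabilizerSubgroup Φ with hS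
  set V : Subgroup (finAdelic (↥(maximalRealSubfield L)) L (IsCMField.complexConj L) 3 H) :=
    finCongruenceLevel (↥(maximalRealSubfield L)) L (IsCMField.complexConj L) 3 H ⊤ ⊓ S with hV
  have hVc : IsCompact (V : Set (finAdelic (↥(maximalRealSubfield L)) L (IsCMField.complexConj L) 3 H)) :=
    hK0c.inter_right (Subgroup.isClosed_of_isOpen _ hSo)
  have hVo : IsOpen (V : Set (finAdelic (↥(maximalRealSubfield L)) L (IsCMField.complexConj L) 3 H)) := hK0o.inter hSo
  -- `U = K_c · (1, V)`, the range of the product homomorphism `K_c × V → U(H)(𝔸)` (the factors commute)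
  have hcommKV : ∀ (m : cmCompactFactor L ι H T hT) (n : V),
      Commute ((cmCompactFactor L ι H T hT).subtype m)
        (((finAdelicToAdelic (↥(maximalRealSubfield L)) L (IsCMField.complexConj L) 3 H).comp V.subtype) n) :=
    fun m n => mul_finAdelicToAdelic_of_mem_cmCompactFactor L ι H T hT m.2 _
  refine ⟨((cmCompactFactor L ι H T hT).subtype.noncommCoprod
      ((finAdelicToAdelic (↥(maximalRealSubfield L)) L (IsCMField.complexConj L) 3 H).comp V.subtype) hcommKV).range, ?_, ?_, ?_, ?_⟩
  · -- compact
    haveI : CompactSpace (cmCompactFactor L ι H T hT) := isCompact_iff_compactSpace.mp (isCompact_cmCompactFactor L ι H T hT hdef)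
    haveI : CompactSpace V := isCompact_iff_compactSpace.mp hVc
    rw [MonoidHom.coe_range]
    refine isCompact_range ?_
    show Continuous fun mn : ↥(cmCompactFactor L ι H T hT) × ↥V =>
      (mn.1 : (adelicGroupData (↥(maximalRealSubfield L)) L (IsCMField.complexConj L) 3 H).Adelic) *
        finAdelicToAdelic (↥(maximalRealSubfield L)) L (IsCMField.complexConj L) 3 H
          (mn.2 : finAdelic (↥(maximalRealSubfield L)) L (IsCMField.complexConj L) 3 H)
    exact (continuous_subtype_val.comp continuous_fst).mul
      ((continuous_finAdelicToAdelic (↥(maximalRealSubfield L)) L (IsCMField.complexConj L) 3 H).comp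
        (continuous_subtype_val.comp continuous_snd))
  · -- commutes with `ι_∞(U(2,1))`
    rintro h _ ⟨⟨m, n⟩, rfl⟩
    rw [MonoidHom.noncommCoprod_apply, Subgroup.coe_subtype, MonoidHom.comp_apply, Subgroup.coe_subtype, ← mul_assoc,
      cmArchSection_mul_of_mem_cmCompactFactor L ι H T hT h m.2, mul_assoc, cmArchSection_mul_finAdelicToAdelic L ι H T hT h, ← mul_assoc]
  · -- `ι_∞(U(2,1)) · U` is open: it contains `{x : x_f ∈ V}`
    refine Subgroup.isOpen_of_mem_nhds _ (g := 1) (Filter.mem_of_superset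
      ((hVo.preimage (continuous_finPart (↥(maximalRealSubfield L)) L (IsCMField.complexConj L) 3 H)).mem_nhds ?_) ?_)
    · rw [Set.mem_preimage, map_one]
      exact V.one_mem
    · intro x hx
      obtain ⟨k, hk, hxeq⟩ := exists_eq_cmArchSection_mul_cmCompactFactor_mul_finAdelicToAdelic L ι H T hT x
      rw [SetLike.mem_coe, hxeq, mul_assoc]
      exact Subgroup.mul_mem _ (Subgroup.mem_sup_left ⟨_, rfl⟩)
        (Subgroup.mem_sup_right ⟨(⟨k, hk⟩, ⟨finPart (↥(maximalRealSubfield L)) L (IsCMField.complexConj L) 3 H x, hx⟩), rfl⟩)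
  · -- `U` fixes the projected classes
    rintro _ ⟨⟨m, n⟩, rfl⟩ j
    rw [MonoidHom.noncommCoprod_apply, Subgroup.coe_subtype, MonoidHom.comp_apply, Subgroup.coe_subtype, map_mul,
      mul_apply_eq_comp, hlev _ (Subgroup.mem_inf.1 n.2).2 j, hKc _ m.2 j]

/-! ## §4 The fold: letter F2 ⇒ letter (D)h -/

/-- **(D)h FOR ONE `P` FROM F2 FOR THAT `P`.**  In the exact setting of ★ `CotangentForms.holCotFormSpectralProjection` (`L` CM, frame `T` of signature `(2,1)`
at `ι`, `H` definite at the other complex places, `[L⁺:ℚ] ≥ 2`, `μ` automorphic, `P` discrete): if the `K`-finite `U`-fixed vectors of `P|_{U(2,1)}` have smooth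
representatives (`P.KFiniteSmoothRepresentative u21Group cmArchSection`, letter F2), then for every `Φ ∈ holCotForms` with square-integrable coordinates the
projected pair `(pr_P[Φ₀], pr_P[Φ₁])` is the pair of classes of a holomorphic cotangent form.  Proof: the quotient is compact (★ `compactSpace_automorphicQuotient_cm`);
F2 applies to `v_j = pr_P[Φ_j]` with the data of §1–§3 (`hfac`, `U`, `K`-finiteness) and yields arch-smooth continuous left-invariant representatives `Ψ_j` with
continuous Lie derivatives; ★ `holCotFormSpectralProjection_of_archSmooth_representative` concludes. [cite: Borel1997, Thm. 2.13 and 2.14] [cite: BorelJacquet1979, §4.3 and §4.6]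
[cite: BorelWallach2000, XIII 1.2; VII 2.10] -/
theorem holCotFormSpectralProjection_at_of_F2
    (hdef : ∀ τ' : L →+* ℂ, InfinitePlace.mk τ' ≠ InfinitePlace.mk ι → (H.map τ').PosDef) (h2 : 2 ≤ Module.finrank ℚ ↥(maximalRealSubfield L))
    {μ : Measure (adelicGroupData (↥(maximalRealSubfield L)) L (IsCMField.complexConj L) 3 H).automorphicQuotient}
    [(adelicGroupData (↥(maximalRealSubfield L)) L (IsCMField.complexConj L) 3 H).IsAutomorphicMeasure μ]
    (P : DiscreteAutomorphicRep (adelicGroupData (↥(maximalRealSubfield L)) L (IsCMField.complexConj L) 3 H) μ)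
    (hF2 : P.KFiniteSmoothRepresentative BallForms.u21Group (cmArchSection L ι H T hT))
    {Φ : (adelicGroupData (↥(maximalRealSubfield L)) L (IsCMField.complexConj L) 3 H).Adelic → (Fin 2 → ℂ)}
    (hΦ : Φ ∈ holCotForms (↥(maximalRealSubfield L)) L (IsCMField.complexConj L) 3 H (cmArchSection L ι H T hT) (cmCompactFactor L ι H T hT))
    (hmemΦ : ∀ j : Fin 2, MemLp (toQuotFun (adelicGroupData (↥(maximalRealSubfield L)) L (IsCMField.complexConj L) 3 H) fun g => Φ g j) 2 μ) :
    ∃ Ψ' ∈ holCotForms (↥(maximalRealSubfield L)) L (IsCMField.complexConj L) 3 H (cmArchSection L ι H T hT) (cmCompactFactor L ι H T hT),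
      ∃ hΨ' : ∀ j : Fin 2,
          MemLp (toQuotFun (adelicGroupData (↥(maximalRealSubfield L)) L (IsCMField.complexConj L) 3 H) fun g => Ψ' g j) 2 μ,
        ∀ j : Fin 2,
          P.space.toSubmodule.starProjection
              (MemLp.toLp (toQuotFun (adelicGroupData (↥(maximalRealSubfield L)) L (IsCMField.complexConj L) 3 H) fun g => Φ g j) (hmemΦ j)) =
            MemLp.toLp (toQuotFun (adelicGroupData (↥(maximalRealSubfield L)) L (IsCMField.complexConj L) 3 H) fun g => Ψ' g j) (hΨ' j) := by
  haveI := compactSpace_automorphicQuotient_cm (H := H) hdef h2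
  obtain ⟨hmemP, -, -, -⟩ := projectedClasses_type P hΦ hmemΦ
  obtain ⟨U, hUc, hUcomm, hUopen, hUfix⟩ := exists_compact_open_level (hT := hT) hdef P hΦ hmemΦ
  have hex := fun j : Fin 2 =>
    DiscreteAutomorphicRep.KFiniteSmoothRepresentative.exists_representative hF2 isStarFormallyReal_complex u21Group_hasCartanDecomposition
      (continuous_archSectionU21CM L ι H T hT) (exists_commuting_complement_cmArchSection hT) hUc hUcomm hUopen
      (v := ⟨_, hmemP j⟩) (mem_kFiniteVectors_of_coe_eq P hΦ hmemΦ j rfl) (fun u hu => hUfix u hu j)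
  choose Ψ hinv _hUinv hcont hsm hLie hrest using hex
  choose hmemΨ hclass using hrest
  exact holCotFormSpectralProjection_of_archSmooth_representative hdef h2 P hΦ hmemΦ (Ψ := fun g j => Ψ j g)
    (fun γ hγ x => funext fun j => hinv j γ hγ x) hcont hsm
    (fun b j => DiscreteAutomorphicRep.KFiniteSmoothRepresentative.continuous_lieDeriv (hLie j) (BallForms.liePMat b))
    hmemΨ (fun j => (hclass j).symm)

/-- **LETTER F2 ⇒ LETTER (D)h** (ENGINE-INTERFACES §7j: «(D)h at rung 1 = F2 alone»).  If, at every CM frame `(L, ι, H, T, hT)` of the letter's setting and for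
every automorphic `μ` and discrete `P`, the `K`-finite vectors of `P|_{U(2,1)}` along `cmArchSection` have smooth representatives (★
`DiscreteAutomorphicRep.KFiniteSmoothRepresentative`, [Borel1997, Thm. 2.13–2.14]; [BorelJacquet1979, §4.3, §4.6]), then ★ `CotangentForms.holCotFormSpectralProjection`
holds. [cite: Borel1997, Thm. 2.13 and 2.14] [cite: BorelJacquet1979, §4.3 and §4.6] [cite: BorelWallach2000, XIII 1.2; VII 2.10] -/
theorem holCotFormSpectralProjection_of_F2
    (hF2 : ∀ (L : Type) [Field L] [NumberField L] [IsCMField L] (ι : L →+* ℂ) (H : Matrix (Fin 3) (Fin 3) L) (T : GL (Fin 3) ℂ)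
      (hT : (T : Matrix (Fin 3) (Fin 3) ℂ)ᴴ * H.map ι * (T : Matrix (Fin 3) (Fin 3) ℂ) = BallModel.J)
      (μ : Measure (adelicGroupData (↥(maximalRealSubfield L)) L (IsCMField.complexConj L) 3 H).automorphicQuotient)
      [(adelicGroupData (↥(maximalRealSubfield L)) L (IsCMField.complexConj L) 3 H).IsAutomorphicMeasure μ]
      (P : DiscreteAutomorphicRep (adelicGroupData (↥(maximalRealSubfield L)) L (IsCMField.complexConj L) 3 H) μ),
      P.KFiniteSmoothRepresentative BallForms.u21Group (cmArchSection L ι H T hT)) :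
    holCotFormSpectralProjection := by
  intro L _ _ _ ι H T hT hdef h2 μ _ P Φ hΦ hmemΦ
  exact holCotFormSpectralProjection_at_of_F2 hdef h2 P (hF2 L ι H T hT μ P) hΦ hmemΦ

/-- **LETTER F2 ⇒ LETTER (D̄)** (the antiholomorphic spectral projection ★ `CotangentForms.antiholCotFormSpectralProjection`): by complex conjugation on
the automorphic side, (D) for all `P` gives (D̄) for all `P` (F0P2-p01's ★ `antiholCotFormSpectralProjection_of_hol`), and (D) is
`holCotFormSpectralProjection_of_F2`. [cite: Borel1997, Thm. 2.13 and 2.14] [cite: BorelJacquet1979, §4.6] [cite: BorelWallach2000, VII 2.10] -/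
theorem antiholCotFormSpectralProjection_of_F2
    (hF2 : ∀ (L : Type) [Field L] [NumberField L] [IsCMField L] (ι : L →+* ℂ) (H : Matrix (Fin 3) (Fin 3) L) (T : GL (Fin 3) ℂ)
      (hT : (T : Matrix (Fin 3) (Fin 3) ℂ)ᴴ * H.map ι * (T : Matrix (Fin 3) (Fin 3) ℂ) = BallModel.J)
      (μ : Measure (adelicGroupData (↥(maximalRealSubfield L)) L (IsCMField.complexConj L) 3 H).automorphicQuotient)
      [(adelicGroupData (↥(maximalRealSubfield L)) L (IsCMField.complexConj L) 3 H).IsAutomorphicMeasure μ]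
      (P : DiscreteAutomorphicRep (adelicGroupData (↥(maximalRealSubfield L)) L (IsCMField.complexConj L) 3 H) μ),
      P.KFiniteSmoothRepresentative BallForms.u21Group (cmArchSection L ι H T hT)) :
    antiholCotFormSpectralProjection :=
  antiholCotFormSpectralProjection_of_hol (holCotFormSpectralProjection_of_F2 hF2)

/-- **LETTER F2 ⇒ BOTH SPECTRAL-PROJECTION LETTERS (D) ∧ (D̄)** — the pair `(hDh, hDa)` consumed by the S5 / S3 / S4 folds and the eight-letter head ★
`HJ3aOfLetters.hJ3a_of_letters`, from the ONE regularity letter F2. [cite: Borel1997, Thm. 2.13 and 2.14] [cite: BorelJacquet1979, §4.3 and §4.6] -/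
theorem cotFormSpectralProjection_of_F2
    (hF2 : ∀ (L : Type) [Field L] [NumberField L] [IsCMField L] (ι : L →+* ℂ) (H : Matrix (Fin 3) (Fin 3) L) (T : GL (Fin 3) ℂ)
      (hT : (T : Matrix (Fin 3) (Fin 3) ℂ)ᴴ * H.map ι * (T : Matrix (Fin 3) (Fin 3) ℂ) = BallModel.J)
      (μ : Measure (adelicGroupData (↥(maximalRealSubfield L)) L (IsCMField.complexConj L) 3 H).automorphicQuotient)
      [(adelicGroupData (↥(maximalRealSubfield L)) L (IsCMField.complexConj L) 3 H).IsAutomorphicMeasure μ]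
      (P : DiscreteAutomorphicRep (adelicGroupData (↥(maximalRealSubfield L)) L (IsCMField.complexConj L) 3 H) μ),
      P.KFiniteSmoothRepresentative BallForms.u21Group (cmArchSection L ι H T hT)) :
    holCotFormSpectralProjection ∧ antiholCotFormSpectralProjection :=
  ⟨holCotFormSpectralProjection_of_F2 hF2, antiholCotFormSpectralProjection_of_F2 hF2⟩

end CM

end Summit.HodgeConjecture.HodgeConjecture.Cruxes.H413.F0P3HolProjectionOfF2

end
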